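import Mathlib
import Literature.MathematicalPhysics.QuantumFieldTheory.Balaban1983to89.B11MeanValue190
import Literature.MathematicalPhysics.QuantumFieldTheory.Balaban1983to89.B11Claim309UAnalytic

/-!
# `Balaban1983to89.B11MeanValue190Chart` — [Balaban1985Variational] Prop. 9 p. 309 «The function 𝓗(B) is determined by Eqs. (174),
# (175) … It is an analytic function of B» ⇒ the MEAN-VALUE DOMINATION `hmv` of the (190)-knitting programme for THE CHART ITSELF:
# differentiability of `τ ↦ 𝓗(τB)` along the segment DERIVED from the analyticity of the chart (p07 `B11Eq174Chart.chartHB`, r08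
# `B11Claim309UAnalytic.analyticOnNhd_chartH`), `𝓗(0) = 0` from (175), the derivative family = the Fréchet derivative `D𝓗(tB)` of
# Prop. 9's (190) at the points `tB` of the ball

statement-level skeleton of published theorems with citation tags; proofs where landed; nothing here is a claim about
the Yang–Mills mass gap.

CITATION HEADER (lean-in-tree rule 2026-08-18).  T. Bałaban, *The variational problem and background fields in renormalization group
method for lattice gauge theories*, Commun. Math. Phys. **102**, 277–309 (1985), doi:10.1007/BF01229381, bib `Balaban1985Variational`
(cell paper B11 = [15] of [Balaban1989LargeFieldI]; Prop. 9 p. 309, (190) p. 308, (174)–(177) pp. 305–306, Prop. 6 pp. 295–296).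
PDF held: `paper:balaban1985-cmp102-variational-background` (journal page = PDF page + 276); the displays as transcribed and
render-verified in `B11Eq174Chart` / `B11Prop6Scheme` / `B11Claim309UAnalytic` (nothing re-read from a secondary source).
Consumers: T. Bałaban, CMP **122** (1989) 175–202 [Balaban1989LargeFieldI] §1 (B15) and CMP **119** (1988) 243–285
[Balaban1988Convergent] §3 (B14) — every «(190)-knit» of the cell.

WHAT IS REPRODUCED — SKELETON rows B11.Prop9 / B11.Eq174 / B11.Claim@309 (owner r08), B15.Eq1.31/1.37–1.39/1.42/1.45–1.48/1.57–1.58/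
1.87/1.90–1.98 (r12), B14.Eq3.7–3.8/3.18–3.19 (r11); GAPS G-B15-r12-08 **Addendum 3 (e′)** (r12 gen 10, 2026-08-21T20:15Z), verbatim:
*«in place of `hmv`: ℍ(0) = 0 and the pointwise differentiability of the CONCRETE ℍ of [15] (174)–(175) along the segment τ ↦ ℍ(τB) with
the derivative family fed to (190) ([15] Sect. G analyticity on Prop. 9՚s ball; r08՚s `B11Claim309UAnalytic` p298687 is the
analyticity-in-U statement, not yet this instance)»*.  THIS FILE IS THAT INSTANCE.  Unit `lit-balaban-p29` gen 9 (Phase-2 free target,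
G.5-34(d)), HOME `run/shared/lean/pub/lit-balaban/`.

THE PRINT (p. 309, PROPOSITION 9, verbatim as quoted in `B11Eq174Chart`): *«The function U_k(V′V₀)U_k(V₀)⁻¹ transformed to the Landau
gauge is, by the definition, equal to exp iη𝓗(B), where B = (1/i) log V′. The function 𝓗(B) is determined by Eqs. (174), (175), or
(179), (180). It is an analytic function of B …»*, and (190) p. 308 bounds *«|(δ/δB_ν(y′))𝓗_μ(B,x)|, |∇_x(δ/δB_ν(y′))𝓗_μ(B,x)|, …»* — the
FRÉCHET DERIVATIVE `D𝓗(B′)` at the points `B′` of Prop. 9's ball — while every consumer sentence of [Balaban1989LargeFieldI] §1 /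
[Balaban1988Convergent] §3 bounds the VALUE `ℍ(B)`.  The cell's knits carry the passage as the hypothesis
`hmv : ∀ s, (∀ t, bout.loc y (dH t B) ≤ s) → bout.loc y (ℍ B) ≤ s`; `B11MeanValue190` (p29 gen 8) reduced it to `ℍ(0) = 0` + pointwise
differentiability of `τ ↦ ℍ(τB)(x)` with derivative `(dH τ B)(x)`; here both are DERIVED for the chart of (174)–(175)/(179)–(180).

THE OBJECTS (all BY NAME, nothing restated).  `B11Eq174Chart.chartHB 𝒢 Λ W J T ε₄ H₁ B = T(𝒜(H₁B) + H₁B)` — 𝓗 as a function of `B`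
over the Sect. E–G scheme (`𝒜 = solA …` the solution of (175)/(180) in the ball (115), `T` = the Sect. C map (47) `A′ ↦ A′ − HD(A′)`,
`H₁ : 𝒳 →L[ℂ] 𝒴` = the linear minimiser (103)/(129)); `B11Eq174Chart.Regime` = the printed conditions (117)–(121);
`B11Claim309UAnalytic.analyticOnNhd_chartH` = «the equations determine an analytic function 𝓗» for parameter-dependent data; the output
sizes of record `B11SupSize190.supSize` (values) and `B11SeminormSize190.covDerivBlockSize` / `ofSeminorms … covDerivSize` (first order);
`B11MeanValue190.hmv_supSize_of_forall` / `hmv_covDerivBlockSize` / `hmv_ofSeminorms_smul_covDerivSize`.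

WHAT THIS FILE PROVES (kernel-checked, zero `sorry`, theorems only — no definition, no named fact; axioms standard).  Throughout:
complex Banach spaces `𝒳` (block fields `B`), `𝒴` (the space (115)), `𝒵`; a `Regime 𝒢 Λ W B₀ θ C₄ a₃ j a ε₄`; the ANALYTICITY
LETTERS of print's premise — `W = (δ/δA′)V` analytic on `{‖Y‖ < a₃}` (Prop. 4 p. 292 «an analytic function on this space») and `T`
analytic on `{‖Y‖ < ε₄ + a}` (p. 305 «The function on the right-hand side of (174) is an analytic function of 𝒜₁ + H₁B») — exactly the
hypothesis shapes of `B11Claim309UAnalytic`; and the region `{B : ‖H₁B‖ < a}` (print: `|H₁B| ≤ B₀|B|`, `|B| < 2dLC₁ε₁`).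
§1 [folklore] chain rule along a ray: `Φ` Fréchet-differentiable at `t•B` ⇒ `τ ↦ ev(Φ(τ•B))` has derivative `ev(DΦ(t•B)·B)` at `t`
   for every real CLM `ev` (private).
§2 **`analyticOnNhd_chartHB`** — «It is an analytic function of B» IN THE FRÉCHET SENSE: `B ↦ chartHB 𝒢 Λ W J T ε₄ H₁ B` is analytic on
   the open region `{B : ‖H₁B‖ < a}` (r08's parameter theorem with parameter space := the `B`-space, data constant in `B` except
   `𝔄(B) = H₁B`); `hasFDerivAt_chartHB_smul` — hence Fréchet-differentiable (over `ℝ`) at every point `t•B`, `t ∈ [0,1]`, of the segment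
   (`‖H₁(tB)‖ = t‖H₁B‖ < a`).
§3 **`hasDerivWithinAt_eval_chartHB`** — THE SEGMENT: for every real CLM `ev : 𝒴 →L[ℝ] E` (evaluation of a component at a lattice
   point), `τ ↦ ev(𝓗(τB))` has derivative `ev(D𝓗(tB)·B)` within `[0,1]` at every `t ∈ [0,1]`; **`chartHB_zero`** — `𝓗(0) = 0` (`J = 0`,
   `T 0 = 0`: (175) at `B = 0` has the solution `𝒜 = 0`).
§4 **`hmv` FOR THE CHART at the sizes of record**, no differentiability hypothesis left: for ANY presentation `H B x = ev x (𝓗(B))` of the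
   lattice field through real CLMs `ev x` and ANY derivative family with `(dH t B)(x) = ev x (D𝓗(tB)·B)` (`D` = `fderiv ℝ`, the
   real-linear Fréchet derivative = the restriction of scalars of the complex one, `fderiv_chartHB_restrictScalars`):
   **`hmv_supSize_chart`** (`bout := supSize g box blk`, the consumers' `hmv`/`hmv₀`), **`hmv_covDerivBlockSize_chart`** and
   **`hmv_ofSeminorms_smul_covDerivSize_chart`** (first-order sizes on the `ℤᵈ` carriers, background `U₀` fixed; `hmv₁` of
   `B15From190LayerSizes.ineq148_of_ineq190_layer` with `c = (L^iη).toNNReal`).  The derivative family is CANONICAL: `dH t` is the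
   pointwise-evaluated Fréchet derivative `D𝓗(tB)` — the object Prop. 9's (190) bounds, at the point `tB` of its ball.
HONEST SCOPE.  What REMAINS for the consumers after this file, exactly: (190) ITSELF for `dH t = D𝓗(tB)` between the concrete sizes
(`Ineq190 (supSize …) (supSize …/covDerivBlockSize …) (dH t) C δ₀` = [15] Prop. 9, row B11.Prop9, typed — the B11 block), (2.61) `RowSum`,
and the geometry/letters listed in GAPS G-B15-r12-08 Addendum 3 (c′)/(f).  The analyticity of `W` and `T` is print's own premise (Prop. 4;
Sect. C), carried as the `AnalyticOnNhd` letters exactly as in `B11Claim309UAnalytic` (the weaker `DifferentiableOn ℂ` letter of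
`B11Prop6Scheme.Prop4Hyp` is implied by it; Mathlib has «ℂ-differentiable on an open set ⇒ analytic» in one variable only, so the
analytic letter is the usable one for a Banach parameter — said, not hidden).  No lattice object is constructed: the identification of the
evaluations `ev x` with the components `𝓗_μ(B, x)` on `T_η` is the instantiation of `𝒴` as the space (115) of lattice configurations
(finite lattice ⇒ every coordinate functional is a CLM).  NOT summit progress.
-/

namespace Literature.MathematicalPhysics.QuantumFieldTheory.Balaban1983to89.B11MeanValue190Chart

open Literature.MathematicalPhysics.QuantumFieldTheory.Balaban1983to89
open B11SectG B11SupSize190 B11SeminormSize190 B11Eq174Chart B11Claim309UAnalytic B11MeanValue190 Set Metric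
open scoped NNReal

/-! ## §1. [folklore] The chain rule along a ray, evaluated by a real CLM -/

section Ray

variable {𝒳 𝒴 E : Type*} [NormedAddCommGroup 𝒳] [NormedSpace ℝ 𝒳] [NormedAddCommGroup 𝒴] [NormedSpace ℝ 𝒴]
  [NormedAddCommGroup E] [NormedSpace ℝ E]

/-- `Φ` Fréchet-differentiable at `t•B` with derivative `Φ'` ⇒ `τ ↦ ev (Φ (τ•B))` has derivative `ev (Φ' B)` at `t`. [folklore] -/
private theorem hasDerivAt_eval_comp_smul {Φ : 𝒳 → 𝒴} {Φ' : 𝒳 →L[ℝ] 𝒴} {B : 𝒳} {t : ℝ}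
    (hΦ : HasFDerivAt Φ Φ' (t • B)) (ev : 𝒴 →L[ℝ] E) :
    HasDerivAt (fun τ : ℝ => ev (Φ (τ • B))) (ev (Φ' B)) t := by
  have hline : HasDerivAt (fun τ : ℝ => τ • B) B t := by
    simpa using (hasDerivAt_id t).smul_const B
  have h1 : HasDerivAt (fun τ : ℝ => Φ (τ • B)) (Φ' B) t := hΦ.comp_hasDerivAt t hline
  exact ev.hasFDerivAt.comp_hasDerivAt t h1

end Ray

/-! ## §2. «It is an analytic function of B» in the Fréchet sense (Prop. 9 via `B11Claim309UAnalytic`) -/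

section Chart

variable {𝒳 𝒴 𝒵 : Type*} [NormedAddCommGroup 𝒳] [NormedSpace ℂ 𝒳] [CompleteSpace 𝒳]
  [NormedAddCommGroup 𝒴] [NormedSpace ℂ 𝒴] [CompleteSpace 𝒴] [NormedAddCommGroup 𝒵] [NormedSpace ℂ 𝒵] [CompleteSpace 𝒵]
variable {𝒢 : 𝒵 →L[ℂ] 𝒴} {Λ : 𝒴 →L[ℂ] 𝒴} {W : 𝒴 → 𝒵} {J : 𝒵} {T : 𝒴 → 𝒴} {B₀ θ C₄ a₃ j a ε₄ : ℝ} {H₁ : 𝒳 →L[ℂ] 𝒴}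

/-- **«The function 𝓗(B) … is an analytic function of B»** (Prop. 9) IN THE FRÉCHET SENSE: under a regime (117)–(121), `‖J‖ ≤ j`, and the
analyticity letters for `W = (δ/δA′)V` (Prop. 4) and the Sect. C map `T`, the chart `B ↦ 𝓗(B) = chartHB 𝒢 Λ W J T ε₄ H₁ B` is analytic on
the open region `{B : ‖H₁B‖ < a}` — `B11Claim309UAnalytic.analyticOnNhd_chartH` with the parameter := `B` itself (data constant in the
parameter except `𝔄(B) = H₁B`). [cite: Balaban1985Variational, Prop. 9 p.309, (174)-(175) p.305] -/
theorem analyticOnNhd_chartHB (R : Regime 𝒢 Λ W B₀ θ C₄ a₃ j a ε₄) (hJ : ‖J‖ ≤ j)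
    (hW : AnalyticOnNhd ℂ W {Y : 𝒴 | ‖Y‖ < a₃}) (hT : AnalyticOnNhd ℂ T {Y : 𝒴 | ‖Y‖ < ε₄ + a}) :
    AnalyticOnNhd ℂ (fun B : 𝒳 => chartHB 𝒢 Λ W J T ε₄ H₁ B) {B : 𝒳 | ‖H₁ B‖ < a} := by
  have h𝒪 : IsOpen {B : 𝒳 | ‖H₁ B‖ < a} := isOpen_lt H₁.continuous.norm continuous_const
  have hWj : AnalyticOnNhd ℂ (fun p : 𝒳 × 𝒴 => W p.2) ({B : 𝒳 | ‖H₁ B‖ < a} ×ˢ {Y : 𝒴 | ‖Y‖ < a₃}) :=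
    fun p hp => (hW p.2 hp.2).comp analyticAt_snd
  have hTj : AnalyticOnNhd ℂ (fun p : 𝒳 × 𝒴 => T p.2) ({B : 𝒳 | ‖H₁ B‖ < a} ×ˢ {Y : 𝒴 | ‖Y‖ < ε₄ + a}) :=
    fun p hp => (hT p.2 hp.2).comp analyticAt_snd
  exact analyticOnNhd_chartH (𝒢 := fun _ : 𝒳 => 𝒢) (Λ := fun _ : 𝒳 => Λ) (W := fun _ : 𝒳 => W) (J := fun _ : 𝒳 => J)
    (𝔄 := fun B : 𝒳 => H₁ B) (Tm := fun _ : 𝒳 => T) h𝒪 (fun _ _ => R) (fun _ _ => hJ) (fun _ hB => hB)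
    analyticOnNhd_const analyticOnNhd_const hWj analyticOnNhd_const (H₁.analyticOnNhd _) hTj

omit [CompleteSpace 𝒳] [CompleteSpace 𝒴] in
/-- A real multiple `t•B`, `t ∈ [0,1]`, of a point of the region stays in the region: `‖H₁(tB)‖ = t‖H₁B‖ ≤ ‖H₁B‖ < a`.
[cite: Balaban1985Variational, Prop. 9 p.309] -/
theorem norm_H₁_smul_lt {B : 𝒳} (hB : ‖H₁ B‖ < a) {t : ℝ} (ht : t ∈ Icc (0:ℝ) 1) : ‖H₁ (t • B)‖ < a := by
  rw [H₁.map_smul_of_tower, norm_smul, Real.norm_eq_abs, abs_of_nonneg ht.1]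
  exact (mul_le_of_le_one_left (norm_nonneg _) ht.2).trans_lt hB

/-- **Fréchet differentiability along the segment** (over `ℝ`, the scalars of the consumers): at every `t•B`, `t ∈ [0,1]`, with
`‖H₁B‖ < a`, the chart has the real Fréchet derivative `fderiv ℝ 𝓗 (tB)` («analytic function of B» restricted to real scalars).
[cite: Balaban1985Variational, Prop. 9 p.309] -/
theorem hasFDerivAt_chartHB_smul (R : Regime 𝒢 Λ W B₀ θ C₄ a₃ j a ε₄) (hJ : ‖J‖ ≤ j)
    (hW : AnalyticOnNhd ℂ W {Y : 𝒴 | ‖Y‖ < a₃}) (hT : AnalyticOnNhd ℂ T {Y : 𝒴 | ‖Y‖ < ε₄ + a})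
    {B : 𝒳} (hB : ‖H₁ B‖ < a) {t : ℝ} (ht : t ∈ Icc (0:ℝ) 1) :
    HasFDerivAt (fun B' : 𝒳 => chartHB 𝒢 Λ W J T ε₄ H₁ B')
      (fderiv ℝ (fun B' : 𝒳 => chartHB 𝒢 Λ W J T ε₄ H₁ B') (t • B)) (t • B) :=
  (((analyticOnNhd_chartHB R hJ hW hT) (t • B) (norm_H₁_smul_lt hB ht)).differentiableAt.restrictScalars ℝ).hasFDerivAt

/-- The real Fréchet derivative used below IS the complex one with scalars restricted (`(δ/δB)𝓗` of (190) is complex-linear).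
[cite: Balaban1985Variational, (190) p.308, Prop. 9 p.309] -/
theorem fderiv_chartHB_restrictScalars (R : Regime 𝒢 Λ W B₀ θ C₄ a₃ j a ε₄) (hJ : ‖J‖ ≤ j)
    (hW : AnalyticOnNhd ℂ W {Y : 𝒴 | ‖Y‖ < a₃}) (hT : AnalyticOnNhd ℂ T {Y : 𝒴 | ‖Y‖ < ε₄ + a})
    {B' : 𝒳} (hB' : ‖H₁ B'‖ < a) :
    fderiv ℝ (fun B : 𝒳 => chartHB 𝒢 Λ W J T ε₄ H₁ B) B' =
      (fderiv ℂ (fun B : 𝒳 => chartHB 𝒢 Λ W J T ε₄ H₁ B) B').restrictScalars ℝ :=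
  (((analyticOnNhd_chartHB R hJ hW hT) B' hB').differentiableAt).fderiv_restrictScalars ℝ

/-! ## §3. The segment `τ ↦ 𝓗(τB)` and `𝓗(0) = 0` -/

/-- **THE SEGMENT**: for every real CLM `ev : 𝒴 →L[ℝ] E` (e.g. the evaluation of a component at a lattice point) the path
`τ ↦ ev(𝓗(τB))` has derivative `ev(D𝓗(tB)·B)` within `[0,1]` at every `t ∈ [0,1]` (`‖H₁B‖ < a`) — the differentiability hypothesis of
`B11MeanValue190` DERIVED from «It is an analytic function of B». [cite: Balaban1985Variational, Prop. 9 p.309, (190) p.308] -/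
theorem hasDerivWithinAt_eval_chartHB (R : Regime 𝒢 Λ W B₀ θ C₄ a₃ j a ε₄) (hJ : ‖J‖ ≤ j)
    (hW : AnalyticOnNhd ℂ W {Y : 𝒴 | ‖Y‖ < a₃}) (hT : AnalyticOnNhd ℂ T {Y : 𝒴 | ‖Y‖ < ε₄ + a})
    {E : Type*} [NormedAddCommGroup E] [NormedSpace ℝ E] (ev : 𝒴 →L[ℝ] E) {B : 𝒳} (hB : ‖H₁ B‖ < a)
    {t : ℝ} (ht : t ∈ Icc (0:ℝ) 1) :
    HasDerivWithinAt (fun τ : ℝ => ev (chartHB 𝒢 Λ W J T ε₄ H₁ (τ • B)))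
      (ev (fderiv ℝ (fun B' : 𝒳 => chartHB 𝒢 Λ W J T ε₄ H₁ B') (t • B) B)) (Icc (0:ℝ) 1) t :=
  (hasDerivAt_eval_comp_smul (hasFDerivAt_chartHB_smul R hJ hW hT hB ht) ev).hasDerivWithinAt

omit [CompleteSpace 𝒳] [CompleteSpace 𝒵] in
/-- **`𝓗(0) = 0`** for the chart as a function of `B` (`J = 0`, `T 0 = 0`; (175) at `B = 0` is solved by `𝒜 = 0`, Prop. 9's
U_k(V₀)U_k(V₀)⁻¹ = 1 = exp iη·0). [cite: Balaban1985Variational, (175) p.305, Prop. 9 p.309] -/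
theorem chartHB_zero (R : Regime 𝒢 Λ W B₀ θ C₄ a₃ j a ε₄) (hj : 0 ≤ j) (ha : 0 < a) (hT0 : T 0 = 0) :
    chartHB 𝒢 Λ W 0 T ε₄ H₁ (0 : 𝒳) = 0 := by
  rw [chartHB, map_zero]
  exact R.chartH_zero hj ha hT0

/-! ## §4. `hmv` for the chart at the output sizes of record -/

section Presentation

variable {X : Type*} {E : Type*} [NormedAddCommGroup E] [NormedSpace ℝ E]

/-- **The two hypotheses of `B11MeanValue190` for ANY presentation of the chart through real CLMs**: if `H B x = ev x (𝓗(B))` and the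
derivative family satisfies `(dH t B)(x) = ev x (D𝓗(tB)·B)` for `t ∈ [0,1]`, then `H 0 = 0` and `τ ↦ H(τB)(x)` has derivative
`(dH τ B)(x)` within `[0,1]` at every `τ ∈ [0,1]`, `x : X` (`J = 0`, `T 0 = 0`, `‖H₁B‖ < a`).
[cite: Balaban1985Variational, Prop. 9 p.309, (175) p.305] -/
theorem presentation_hyps (R : Regime 𝒢 Λ W B₀ θ C₄ a₃ j a ε₄) (hj : 0 ≤ j)
    (hW : AnalyticOnNhd ℂ W {Y : 𝒴 | ‖Y‖ < a₃}) (hT : AnalyticOnNhd ℂ T {Y : 𝒴 | ‖Y‖ < ε₄ + a}) (hT0 : T 0 = 0)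
    (ev : X → (𝒴 →L[ℝ] E)) (H : 𝒳 → X → E) (dH : Icc (0:ℝ) 1 → 𝒳 →ₗ[ℝ] (X → E)) {B : 𝒳} (hB : ‖H₁ B‖ < a)
    (hH : ∀ B' : 𝒳, H B' = fun x => ev x (chartHB 𝒢 Λ W 0 T ε₄ H₁ B'))
    (hdH : ∀ (t : Icc (0:ℝ) 1) (x : X),
      dH t B x = ev x (fderiv ℝ (fun B' : 𝒳 => chartHB 𝒢 Λ W 0 T ε₄ H₁ B') ((t : ℝ) • B) B)) :
    H 0 = 0 ∧ ∀ (x : X) (t : ℝ) (ht : t ∈ Icc (0:ℝ) 1),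
      HasDerivWithinAt (fun τ : ℝ => H (τ • B) x) (dH ⟨t, ht⟩ B x) (Icc (0:ℝ) 1) t := by
  have ha : 0 < a := (norm_nonneg _).trans_lt hB
  refine ⟨?_, fun x t ht => ?_⟩
  · rw [hH 0]
    funext x
    rw [chartHB_zero R hj ha hT0, map_zero]
    rfl
  · rw [hdH ⟨t, ht⟩ x]
    have h := hasDerivWithinAt_eval_chartHB (J := (0 : 𝒵)) R (by simpa using hj) hW hT (ev x) hB ht
    refine h.congr (fun τ _ => ?_) ?_
    · rw [hH]
    · rw [hH]

end Presentation

section Values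

variable {g : B6.Geometry} {X : Type} {E : Type} [NormedAddCommGroup E] [NormedSpace ℝ E]
variable {box : g.Site → Finset X} {blk : X → g.Site}

/-- **`hmv` FOR THE CHART, VALUES** (`bout := supSize g box blk`): for any presentation `H B x = ev x (𝓗(B))` of the chart's lattice
field through real CLMs and the derivative family `(dH t B)(x) = ev x (D𝓗(tB)·B)` — Prop. 9's `(δ/δB)𝓗` at the point `tB` —
`∀ s, (∀ t, loc y (dH t B) ≤ s) → loc y (H B) ≤ s`, i.e. EXACTLY the consumers' `hmv` (`B15HDecayLeaves.loc_le_of_meanValue`, `hmv₀` of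
`B15From190LayerSizes`, `hmv` of `B14From190LayerSizes`/`B14From190SupSize`), with NO differentiability hypothesis: only the regime
(117)–(121), the analyticity letters of Prop. 4 / Sect. C, `T 0 = 0` and `‖H₁B‖ < a`.
[cite: Balaban1985Variational, Prop. 9 (190) pp.308-309, (174)-(175) p.305] -/
theorem hmv_supSize_chart (R : Regime 𝒢 Λ W B₀ θ C₄ a₃ j a ε₄) (hj : 0 ≤ j)
    (hW : AnalyticOnNhd ℂ W {Y : 𝒴 | ‖Y‖ < a₃}) (hT : AnalyticOnNhd ℂ T {Y : 𝒴 | ‖Y‖ < ε₄ + a}) (hT0 : T 0 = 0)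
    (ev : X → (𝒴 →L[ℝ] E)) (H : 𝒳 → X → E) (dH : Icc (0:ℝ) 1 → 𝒳 →ₗ[ℝ] (X → E)) {B : 𝒳} (hB : ‖H₁ B‖ < a)
    (hH : ∀ B' : 𝒳, H B' = fun x => ev x (chartHB 𝒢 Λ W 0 T ε₄ H₁ B'))
    (hdH : ∀ (t : Icc (0:ℝ) 1) (x : X),
      dH t B x = ev x (fderiv ℝ (fun B' : 𝒳 => chartHB 𝒢 Λ W 0 T ε₄ H₁ B') ((t : ℝ) • B) B))
    (y : g.Site) :
    ∀ s : ℝ, (∀ t, (supSize g box blk : BlockNorm g (X → E)).loc y (dH t B) ≤ s) →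
      (supSize g box blk : BlockNorm g (X → E)).loc y (H B) ≤ s := by
  obtain ⟨h0, hderiv⟩ := presentation_hyps R hj hW hT hT0 ev H dH hB hH hdH
  exact hmv_supSize_of_forall H dH B y h0 hderiv

/-- The same with the CANONICAL derivative family written out: `dH t = (x ↦ ev x ∘ D𝓗(tB))` as a real-linear map.
[cite: Balaban1985Variational, Prop. 9 (190) pp.308-309] -/
theorem hmv_supSize_chart_canonical (R : Regime 𝒢 Λ W B₀ θ C₄ a₃ j a ε₄) (hj : 0 ≤ j)
    (hW : AnalyticOnNhd ℂ W {Y : 𝒴 | ‖Y‖ < a₃}) (hT : AnalyticOnNhd ℂ T {Y : 𝒴 | ‖Y‖ < ε₄ + a}) (hT0 : T 0 = 0)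
    (ev : X → (𝒴 →L[ℝ] E)) {B : 𝒳} (hB : ‖H₁ B‖ < a) (y : g.Site) :
    ∀ s : ℝ, (∀ t : Icc (0:ℝ) 1, (supSize g box blk : BlockNorm g (X → E)).loc y
        ((LinearMap.pi fun x => ((ev x : 𝒴 →L[ℝ] E) : 𝒴 →ₗ[ℝ] E) ∘ₗ
          ((fderiv ℝ (fun B' : 𝒳 => chartHB 𝒢 Λ W 0 T ε₄ H₁ B') ((t : ℝ) • B) : 𝒳 →L[ℝ] 𝒴) : 𝒳 →ₗ[ℝ] 𝒴)) B) ≤ s) →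
      (supSize g box blk : BlockNorm g (X → E)).loc y (fun x => ev x (chartHB 𝒢 Λ W 0 T ε₄ H₁ B)) ≤ s :=
  hmv_supSize_chart R hj hW hT hT0 ev (fun B' x => ev x (chartHB 𝒢 Λ W 0 T ε₄ H₁ B'))
    (fun t => LinearMap.pi fun x => ((ev x : 𝒴 →L[ℝ] E) : 𝒴 →ₗ[ℝ] E) ∘ₗ
      ((fderiv ℝ (fun B' : 𝒳 => chartHB 𝒢 Λ W 0 T ε₄ H₁ B') ((t : ℝ) • B) : 𝒳 →L[ℝ] 𝒴) : 𝒳 →ₗ[ℝ] 𝒴))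
    hB (fun _ => rfl) (fun _ _ => rfl) y

end Values

section CovDeriv

variable {d : ℕ} {𝔸 : Type} [NormedRing 𝔸] [NormedAlgebra ℂ 𝔸] {g : B6.Geometry}

/-- **`hmv` FOR THE CHART, FIRST-ORDER SIZE** `covDerivBlockSize g y₀ S ξ U₀` on the `ℤᵈ` carriers (background `U₀` fixed): same
presentation data with `E := Fin d → 𝔸` (the `d` components at a lattice point), same conclusion — the `hmv` of r11's derivative-size
knits. [cite: Balaban1985Variational, Prop. 9 (190) pp.308-309, (174)-(175) p.305] -/
theorem hmv_covDerivBlockSize_chart (R : Regime 𝒢 Λ W B₀ θ C₄ a₃ j a ε₄) (hj : 0 ≤ j)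
    (hW : AnalyticOnNhd ℂ W {Y : 𝒴 | ‖Y‖ < a₃}) (hT : AnalyticOnNhd ℂ T {Y : 𝒴 | ‖Y‖ < ε₄ + a}) (hT0 : T 0 = 0)
    (ev : B7Prop1Explicit.Site d → (𝒴 →L[ℝ] (Fin d → 𝔸))) (H : 𝒳 → B7Prop1Explicit.Site d → Fin d → 𝔸)
    (dH : Icc (0:ℝ) 1 → 𝒳 →ₗ[ℝ] (B7Prop1Explicit.Site d → Fin d → 𝔸)) {B : 𝒳} (hB : ‖H₁ B‖ < a)
    (hH : ∀ B' : 𝒳, H B' = fun x => ev x (chartHB 𝒢 Λ W 0 T ε₄ H₁ B'))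
    (hdH : ∀ (t : Icc (0:ℝ) 1) (x : B7Prop1Explicit.Site d),
      dH t B x = ev x (fderiv ℝ (fun B' : 𝒳 => chartHB 𝒢 Λ W 0 T ε₄ H₁ B') ((t : ℝ) • B) B))
    {y₀ : g.Site} (y : g.Site) {S : g.Site → Finset (B7Prop1Explicit.Site d × Fin d × Fin d)} {ξ : ℝ}
    {U₀ : B7Prop1Explicit.Site d → Fin d → 𝔸ˣ} :
    ∀ s : ℝ, (∀ t, (covDerivBlockSize g y₀ S ξ U₀).loc y (dH t B) ≤ s) →
      (covDerivBlockSize g y₀ S ξ U₀).loc y (H B) ≤ s := by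
  obtain ⟨h0, hderiv⟩ := presentation_hyps R hj hW hT hT0 ev H dH hB hH hdH
  exact hmv_covDerivBlockSize H dH B y h0 hderiv

/-- **`hmv` FOR THE CHART, WEIGHTED FIRST-ORDER SIZE** `ofSeminorms g y₀ (fun y => c • covDerivSize (S y) ξ U₀)`, `c : ℝ≥0` — EXACTLY
`hmv₁` of `B15From190LayerSizes.ineq148_of_ineq190_layer` (`c = (L^iη).toNNReal`) for the chart.
[cite: Balaban1985Variational, Prop. 9 (190) pp.308-309, (174)-(175) p.305] -/
theorem hmv_ofSeminorms_smul_covDerivSize_chart (R : Regime 𝒢 Λ W B₀ θ C₄ a₃ j a ε₄) (hj : 0 ≤ j)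
    (hW : AnalyticOnNhd ℂ W {Y : 𝒴 | ‖Y‖ < a₃}) (hT : AnalyticOnNhd ℂ T {Y : 𝒴 | ‖Y‖ < ε₄ + a}) (hT0 : T 0 = 0)
    (ev : B7Prop1Explicit.Site d → (𝒴 →L[ℝ] (Fin d → 𝔸))) (H : 𝒳 → B7Prop1Explicit.Site d → Fin d → 𝔸)
    (dH : Icc (0:ℝ) 1 → 𝒳 →ₗ[ℝ] (B7Prop1Explicit.Site d → Fin d → 𝔸)) {B : 𝒳} (hB : ‖H₁ B‖ < a)
    (hH : ∀ B' : 𝒳, H B' = fun x => ev x (chartHB 𝒢 Λ W 0 T ε₄ H₁ B'))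
    (hdH : ∀ (t : Icc (0:ℝ) 1) (x : B7Prop1Explicit.Site d),
      dH t B x = ev x (fderiv ℝ (fun B' : 𝒳 => chartHB 𝒢 Λ W 0 T ε₄ H₁ B') ((t : ℝ) • B) B))
    {y₀ : g.Site} (y : g.Site) {S : g.Site → Finset (B7Prop1Explicit.Site d × Fin d × Fin d)} {ξ : ℝ}
    {U₀ : B7Prop1Explicit.Site d → Fin d → 𝔸ˣ} (c : ℝ≥0) :
    ∀ s : ℝ, (∀ t, (ofSeminorms g y₀ (fun y => c • covDerivSize (S y) ξ U₀)).loc y (dH t B) ≤ s) →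
      (ofSeminorms g y₀ (fun y => c • covDerivSize (S y) ξ U₀)).loc y (H B) ≤ s := by
  obtain ⟨h0, hderiv⟩ := presentation_hyps R hj hW hT hT0 ev H dH hB hH hdH
  exact hmv_ofSeminorms_smul_covDerivSize H dH B y c h0 hderiv

end CovDeriv

end Chart

end Literature.MathematicalPhysics.QuantumFieldTheory.Balaban1983to89.B11MeanValue190Chart
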